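import Mathlib
import HarnessLib
import Literature.NumberTheory.Transcendental.Associators
import Literature.NumberTheory.Transcendental.DrinfeldAssociatorIsGroupLikeProofs
import Literature.NumberTheory.Transcendental.DrinfeldAssociatorPentagonProofs
import Literature.NumberTheory.Transcendental.MultipleZetaRepeatedTwosProofs

/-!
# `KernelModuloPeriodConjecture`, line `Sketch`: the algebraic leaf on the depth-one even family

Crux `FurushoPentagon.KernelModuloPeriodConjecture` (stmt-KontsevichZagierPeriods-15058), line
`Sketch`, registered stub `stub_evenDepthOneLeaf` (skeleton v8, stub (iv)). For every `n ≥ 1` there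
is ONE rational `r_n` with `c_{x₀^{2n-1}x₁}(φ) = r_n · c_{(x₀x₁)ⁿ}(φ)` at every group-like solution `φ`
of Drinfeld's pentagon equation over every commutative `ℚ`-algebra — the algebraic leaf
`AssociatorHoffmanSpanning` on the infinite family of depth-one even indices `s = (2n)`, whose only
Hoffman index entering is `{2}ⁿ` (at `Φ_KZ`: `ζ(2n) ∈ ℚ ζ(2,…,2)`, Euler × Hoffman; the motivic
version `ζᵐ(2n), ζᵐ({2}ⁿ) ∈ ℚ ζᵐ(2)ⁿ` is Brown 2012, §3.3 Lemma 3.4).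

The statement is the lead's glue and takes the three neighbouring stubs as hypotheses: (i) the
depth-one shuffle products of a group-like series (used only to feed (ii)), (ii) Euler's recursion
`(2n+1) c_{(2n)} = -2 Σ_{j=1}^{n-1} c_{(2j)} c_{(2n-2j)}` (`n ≥ 2`) for group-like pentagon solutions,
(iii) Newton's identity for Furusho's `π_Y(φ)` on the indices `{m}ⁿ`. Proof:

1. `evenLeaf_exists_depthOne` — from (ii), by strong induction, universal rationals `a_n` with
   `c_{(2n)}(φ) = a_n c_{(2)}(φ)ⁿ` (`n ≥ 1`), dividing by `2n+1` in the `ℚ`-algebra;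
2. `evenLeaf_exists_piY_replicate_upto` — from (iii) at `m = 2` and step 1, universal rationals
   `q_n` with `π_Y(φ)({2}ⁿ) = q_n c_{(2)}(φ)ⁿ`, dividing by `n+1`;
3. `evenLeaf_q_ne_zero` — `q_n ≠ 0` by evaluation at the real Drinfeld associator `Φ_KZ`, a
   group-like pentagon solution (`drinfeldAssociator_isGroupLike_holds`,
   `drinfeldAssociator_pentagon_holds`), where `π_Y(Φ_KZ)({2}ⁿ) = ζ({2}ⁿ) = π²ⁿ/(2n+1)! ≠ 0`
   (`drinfeldAssociator_binaryWord`, `multipleZeta_replicate_two`);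
4. `r_n = (-1)ⁿ a_n / q_n`, as `π_Y(φ)({2}ⁿ) = (-1)ⁿ c_{binaryWord {2}ⁿ}(φ)`.

References: K. Ihara, M. Kaneko, D. Zagier, *Derivation and double shuffle relations for multiple
zeta values*, Compos. Math. 142 (2006), §2 [IharaKanekoZagier2006]; F. Brown, *Mixed Tate motives
over ℤ*, Ann. of Math. 175 (2012), §3.3 Lemma 3.4 [Brown2012]; M. E. Hoffman, *Multiple harmonic
series*, Pacific J. Math. 152 (1992), Cor. 2.3 [Hoffman1992]; M. E. Hoffman, *The algebra of
multiple harmonic series*, J. Algebra 194 (1997), §2 [Hoffman1997]; H. Furusho, *Double shuffle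
relation for associators*, Ann. of Math. 174 (2011), §2 [Furusho2011].
-/

namespace Summit.KontsevichZagierPeriods.FurushoPentagon.KernelModuloPeriodConjecture

open Literature.NumberTheory.Transcendental

/-- Division by a nonzero rational in a commutative `ℚ`-algebra: from `d · x = y` (the scalar `d`
acting through `algebraMap ℚ R`) to `x = d⁻¹ · y`. [folklore] -/
theorem evenLeaf_eq_inv_mul {R : Type} [CommRing R] [Algebra ℚ R] {d : ℚ} (hd : d ≠ 0) {x y : R}
    (h : algebraMap ℚ R d * x = y) : x = algebraMap ℚ R d⁻¹ * y := by
  rw [← h, ← mul_assoc, ← map_mul, inv_mul_cancel₀ hd, map_one, one_mul]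

/-- The scalar `-2` passes through `algebraMap ℚ R`: `-2 · y = (-2 y)` as images. [folklore] -/
theorem evenLeaf_neg_two_mul {R : Type} [CommRing R] [Algebra ℚ R] (y : ℚ) :
    (-2 : R) * algebraMap ℚ R y = algebraMap ℚ R (-2 * y) := by
  rw [show (-2 : ℚ) * y = -(y + y) by ring, map_neg, map_add]
  ring

/-- **Euler's recursion, solved one step.** If `c_{(2j)}(φ) = a_j c_{(2)}(φ)ʲ` at every group-like
pentagon solution for `1 ≤ j < n` (`n ≥ 2`), then Euler's recursion (stub (ii)) gives
`c_{(2n)}(φ) = a_n c_{(2)}(φ)ⁿ` at every such solution, with the universal rational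
`a_n = (2n+1)⁻¹ · (-2 Σ_{j=1}^{n-1} a_j a_{n-j})` (at `Φ_KZ`: Euler's recursion for `ζ(2n)/ζ(2)ⁿ`).
[cite: IharaKanekoZagier2006, §2] -/
theorem evenLeaf_depthOne_step
    (hEu : ∀ (R : Type) [CommRing R] [Algebra ℚ R] (φ : NCSeries Bool R), NCSeries.IsGroupLike φ →
      NCSeries.DrinfeldPentagon φ → ∀ n : ℕ, 2 ≤ n →
        (2 * n + 1 : R) * φ (MZV.binaryWord [2 * n]) =
          -2 * ∑ j ∈ Finset.Ico 1 n, φ (MZV.binaryWord [2 * j]) * φ (MZV.binaryWord [2 * (n - j)]))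
    {n : ℕ} (hn : 2 ≤ n) (a : ℕ → ℚ)
    (ha : ∀ j : ℕ, 1 ≤ j → j < n → ∀ (R : Type) [CommRing R] [Algebra ℚ R] (φ : NCSeries Bool R),
      NCSeries.IsGroupLike φ → NCSeries.DrinfeldPentagon φ →
        φ (MZV.binaryWord [2 * j]) = algebraMap ℚ R (a j) * φ (MZV.binaryWord [2]) ^ j)
    (R : Type) [CommRing R] [Algebra ℚ R] (φ : NCSeries Bool R) (hg : NCSeries.IsGroupLike φ)
    (h5 : NCSeries.DrinfeldPentagon φ) :
    φ (MZV.binaryWord [2 * n]) =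
      algebraMap ℚ R (((2 * n + 1 : ℕ) : ℚ)⁻¹ * (-2 * ∑ j ∈ Finset.Ico 1 n, a j * a (n - j))) *
        φ (MZV.binaryWord [2]) ^ n := by
  have key := hEu R φ hg h5 n hn
  have hsum : ∑ j ∈ Finset.Ico 1 n, φ (MZV.binaryWord [2 * j]) * φ (MZV.binaryWord [2 * (n - j)]) =
      algebraMap ℚ R (∑ j ∈ Finset.Ico 1 n, a j * a (n - j)) * φ (MZV.binaryWord [2]) ^ n := by
    rw [map_sum, Finset.sum_mul]
    refine Finset.sum_congr rfl fun j hj => ?_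
    rw [Finset.mem_Ico] at hj
    obtain ⟨k, rfl⟩ : ∃ k, n = j + k := ⟨n - j, by omega⟩
    rw [Nat.add_sub_cancel_left, ha j hj.1 (by omega) R φ hg h5,
      ha k (by omega) (by omega) R φ hg h5, map_mul, pow_add]
    ring
  have hcast : (2 * n + 1 : R) = algebraMap ℚ R ((2 * n + 1 : ℕ) : ℚ) := by
    rw [map_natCast]
    norm_cast
  rw [hsum, hcast, ← mul_assoc, evenLeaf_neg_two_mul] at key
  have hd : ((2 * n + 1 : ℕ) : ℚ) ≠ 0 := by positivity
  rw [evenLeaf_eq_inv_mul hd key, ← mul_assoc, ← map_mul]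

/-- **Euler's theorem for pentagon solutions, coefficient form, up to `N + 1`**: universal
rationals `a_j` with `c_{(2j)}(φ) = a_j c_{(2)}(φ)ʲ` for `1 ≤ j ≤ N + 1` at every group-like
pentagon solution over every commutative `ℚ`-algebra (strong induction on Euler's recursion,
`a_1 = 1`). [cite: IharaKanekoZagier2006, §2] -/
theorem evenLeaf_exists_depthOne_upto
    (hEu : ∀ (R : Type) [CommRing R] [Algebra ℚ R] (φ : NCSeries Bool R), NCSeries.IsGroupLike φ →
      NCSeries.DrinfeldPentagon φ → ∀ n : ℕ, 2 ≤ n →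
        (2 * n + 1 : R) * φ (MZV.binaryWord [2 * n]) =
          -2 * ∑ j ∈ Finset.Ico 1 n, φ (MZV.binaryWord [2 * j]) * φ (MZV.binaryWord [2 * (n - j)]))
    (N : ℕ) :
    ∃ a : ℕ → ℚ, ∀ j : ℕ, 1 ≤ j → j ≤ N + 1 →
      ∀ (R : Type) [CommRing R] [Algebra ℚ R] (φ : NCSeries Bool R),
        NCSeries.IsGroupLike φ → NCSeries.DrinfeldPentagon φ →
          φ (MZV.binaryWord [2 * j]) = algebraMap ℚ R (a j) * φ (MZV.binaryWord [2]) ^ j := by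
  induction N with
  | zero =>
    refine ⟨fun _ => 1, fun j hj hj' R _ _ φ _ _ => ?_⟩
    obtain rfl : j = 1 := by omega
    simp
  | succ N ih =>
    obtain ⟨a, ha⟩ := ih
    refine ⟨Function.update a (N + 2)
        (((2 * (N + 2) + 1 : ℕ) : ℚ)⁻¹ * (-2 * ∑ j ∈ Finset.Ico 1 (N + 2), a j * a (N + 2 - j))),
      fun j hj hj' R _ _ φ hg h5 => ?_⟩
    rcases Nat.lt_or_ge j (N + 2) with hlt | hge
    · rw [Function.update_of_ne (Nat.ne_of_lt hlt)]
      exact ha j hj (by omega) R φ hg h5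
    · obtain rfl : j = N + 2 := by omega
      rw [Function.update_self]
      exact evenLeaf_depthOne_step hEu (by omega) a
        (fun i hi hi' S _ _ ψ hψ hψ5 => ha i hi (by omega) S ψ hψ hψ5) R φ hg h5

/-- **Euler's theorem for pentagon solutions, coefficient form**: ONE sequence of rationals `a_n`
with `c_{(2n)}(φ) = a_n c_{(2)}(φ)ⁿ` for every `n ≥ 1`, at every group-like pentagon solution over
every commutative `ℚ`-algebra (at `Φ_KZ`: `ζ(2n) ∈ ℚ ζ(2)ⁿ`, Euler). [cite: IharaKanekoZagier2006, §2] -/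
theorem evenLeaf_exists_depthOne
    (hEu : ∀ (R : Type) [CommRing R] [Algebra ℚ R] (φ : NCSeries Bool R), NCSeries.IsGroupLike φ →
      NCSeries.DrinfeldPentagon φ → ∀ n : ℕ, 2 ≤ n →
        (2 * n + 1 : R) * φ (MZV.binaryWord [2 * n]) =
          -2 * ∑ j ∈ Finset.Ico 1 n, φ (MZV.binaryWord [2 * j]) * φ (MZV.binaryWord [2 * (n - j)])) :
    ∃ a : ℕ → ℚ, ∀ j : ℕ, 1 ≤ j →
      ∀ (R : Type) [CommRing R] [Algebra ℚ R] (φ : NCSeries Bool R),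
        NCSeries.IsGroupLike φ → NCSeries.DrinfeldPentagon φ →
          φ (MZV.binaryWord [2 * j]) = algebraMap ℚ R (a j) * φ (MZV.binaryWord [2]) ^ j := by
  choose a ha using evenLeaf_exists_depthOne_upto hEu
  exact ⟨fun j => a j j, fun j hj R _ _ φ hg h5 => ha j j hj (Nat.le_succ j) R φ hg h5⟩

/-- **Newton's identity, solved one step** (`m = 2`). If `c_{(2j)}(φ) = a_j c_{(2)}(φ)ʲ` (`j ≥ 1`)
and `π_Y(φ)({2}ʲ) = q_j c_{(2)}(φ)ʲ` (`j ≤ N`) at every group-like pentagon solution, then Newton's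
identity for `π_Y(φ)` (stub (iii)) gives `π_Y(φ)({2}^{N+1}) = q_{N+1} c_{(2)}(φ)^{N+1}` with the
universal rational `q_{N+1} = (N+1)⁻¹ Σ_{k=0}^{N} (-1)ᵏ (-a_{k+1}) q_{N-k}` (`π_Y(φ)(Y_{2k+2}) =
-c_{(2k+2)}(φ)`). [cite: Hoffman1997, §2] -/
theorem evenLeaf_piY_replicate_step
    (hNw : ∀ (R : Type) [CommRing R] [Algebra ℚ R] (φ : NCSeries Bool R), NCSeries.IsGroupLike φ →
      NCSeries.DrinfeldPentagon φ → ∀ m : ℕ, 2 ≤ m → ∀ n : ℕ,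
        ((n : R) + 1) * NCSeries.piY φ (List.replicate (n + 1) m) =
          ∑ k ∈ Finset.range (n + 1),
            (-1) ^ k * (NCSeries.piY φ [(k + 1) * m] * NCSeries.piY φ (List.replicate (n - k) m)))
    (a q : ℕ → ℚ)
    (ha : ∀ j : ℕ, 1 ≤ j → ∀ (R : Type) [CommRing R] [Algebra ℚ R] (φ : NCSeries Bool R),
      NCSeries.IsGroupLike φ → NCSeries.DrinfeldPentagon φ →
        φ (MZV.binaryWord [2 * j]) = algebraMap ℚ R (a j) * φ (MZV.binaryWord [2]) ^ j)
    {N : ℕ}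
    (hq : ∀ j : ℕ, j ≤ N → ∀ (R : Type) [CommRing R] [Algebra ℚ R] (φ : NCSeries Bool R),
      NCSeries.IsGroupLike φ → NCSeries.DrinfeldPentagon φ →
        NCSeries.piY φ (List.replicate j 2) = algebraMap ℚ R (q j) * φ (MZV.binaryWord [2]) ^ j)
    (R : Type) [CommRing R] [Algebra ℚ R] (φ : NCSeries Bool R) (hg : NCSeries.IsGroupLike φ)
    (h5 : NCSeries.DrinfeldPentagon φ) :
    NCSeries.piY φ (List.replicate (N + 1) 2) =
      algebraMap ℚ R (((N + 1 : ℕ) : ℚ)⁻¹ *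
          ∑ k ∈ Finset.range (N + 1), (-1) ^ k * (-a (k + 1) * q (N - k))) *
        φ (MZV.binaryWord [2]) ^ (N + 1) := by
  have key := hNw R φ hg h5 2 le_rfl N
  have hsum : ∑ k ∈ Finset.range (N + 1), (-1) ^ k *
        (NCSeries.piY φ [(k + 1) * 2] * NCSeries.piY φ (List.replicate (N - k) 2)) =
      algebraMap ℚ R (∑ k ∈ Finset.range (N + 1), (-1) ^ k * (-a (k + 1) * q (N - k))) *
        φ (MZV.binaryWord [2]) ^ (N + 1) := by
    rw [map_sum, Finset.sum_mul]
    refine Finset.sum_congr rfl fun k hk => ?_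
    rw [Finset.mem_range] at hk
    obtain ⟨i, rfl⟩ : ∃ i, N = k + i := ⟨N - k, by omega⟩
    rw [Nat.add_sub_cancel_left, NCSeries.piY_apply_singleton φ (n := (k + 1) * 2) (by omega),
      Nat.mul_comm (k + 1) 2,
      ha (k + 1) (by omega) R φ hg h5, hq i (by omega) R φ hg h5, map_mul, map_mul, map_neg,
      map_pow, map_neg, map_one]
    ring
  have hcast : ((N : R) + 1) = algebraMap ℚ R ((N + 1 : ℕ) : ℚ) := by
    rw [map_natCast]
    norm_cast
  rw [hsum, hcast] at key
  have hd : ((N + 1 : ℕ) : ℚ) ≠ 0 := by positivity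
  rw [evenLeaf_eq_inv_mul hd key, ← mul_assoc, ← map_mul]

/-- **`π_Y(φ)({2}ʲ) ∈ ℚ c_{(2)}(φ)ʲ` uniformly, up to `N`**: given the universal rationals `a_j` of
`evenLeaf_exists_depthOne`, universal rationals `q_j` with `π_Y(φ)({2}ʲ) = q_j c_{(2)}(φ)ʲ` for
`j ≤ N` at every group-like pentagon solution over every commutative `ℚ`-algebra (`q_0 = 1` as
`π_Y(φ)(∅) = c_∅(φ) = 1`; induction on Newton's identity, stub (iii) at `m = 2`). At `Φ_KZ`:
`ζ({2}ⁿ) ∈ ℚ ζ(2)ⁿ` (Hoffman). [cite: Hoffman1997, §2] -/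
theorem evenLeaf_exists_piY_replicate_upto
    (hNw : ∀ (R : Type) [CommRing R] [Algebra ℚ R] (φ : NCSeries Bool R), NCSeries.IsGroupLike φ →
      NCSeries.DrinfeldPentagon φ → ∀ m : ℕ, 2 ≤ m → ∀ n : ℕ,
        ((n : R) + 1) * NCSeries.piY φ (List.replicate (n + 1) m) =
          ∑ k ∈ Finset.range (n + 1),
            (-1) ^ k * (NCSeries.piY φ [(k + 1) * m] * NCSeries.piY φ (List.replicate (n - k) m)))
    (a : ℕ → ℚ)
    (ha : ∀ j : ℕ, 1 ≤ j → ∀ (R : Type) [CommRing R] [Algebra ℚ R] (φ : NCSeries Bool R),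
      NCSeries.IsGroupLike φ → NCSeries.DrinfeldPentagon φ →
        φ (MZV.binaryWord [2 * j]) = algebraMap ℚ R (a j) * φ (MZV.binaryWord [2]) ^ j)
    (N : ℕ) :
    ∃ q : ℕ → ℚ, ∀ j : ℕ, j ≤ N →
      ∀ (R : Type) [CommRing R] [Algebra ℚ R] (φ : NCSeries Bool R),
        NCSeries.IsGroupLike φ → NCSeries.DrinfeldPentagon φ →
          NCSeries.piY φ (List.replicate j 2) = algebraMap ℚ R (q j) * φ (MZV.binaryWord [2]) ^ j := by
  induction N with
  | zero =>
    refine ⟨fun _ => 1, fun j hj R _ _ φ hg _ => ?_⟩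
    obtain rfl : j = 0 := Nat.le_zero.mp hj
    simp [hg.apply_nil]
  | succ N ih =>
    obtain ⟨q, hq⟩ := ih
    refine ⟨Function.update q (N + 1)
        (((N + 1 : ℕ) : ℚ)⁻¹ * ∑ k ∈ Finset.range (N + 1), (-1) ^ k * (-a (k + 1) * q (N - k))),
      fun j hj R _ _ φ hg h5 => ?_⟩
    rcases Nat.lt_or_ge j (N + 1) with hlt | hge
    · rw [Function.update_of_ne (Nat.ne_of_lt hlt)]
      exact hq j (by omega) R φ hg h5
    · obtain rfl : j = N + 1 := by omega
      rw [Function.update_self]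
      exact evenLeaf_piY_replicate_step hNw a q ha hq R φ hg h5

/-- **Non-vanishing at the Drinfeld associator.** If `π_Y(φ)({2}ⁿ) = q c_{(2)}(φ)ⁿ` at every
group-like pentagon solution over every commutative `ℚ`-algebra, then `q ≠ 0`: the real Drinfeld
associator `Φ_KZ` is such a solution (Drinfeld; tree theorems `drinfeldAssociator_isGroupLike_holds`,
`drinfeldAssociator_pentagon_holds`) and there `π_Y(Φ_KZ)({2}ⁿ) = (-1)ⁿ(-1)ⁿ ζ({2}ⁿ) = π²ⁿ/(2n+1)! ≠ 0`.
[cite: Hoffman1992, Corollary 2.3] -/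
theorem evenLeaf_q_ne_zero {n : ℕ} {q : ℚ}
    (hq : ∀ (R : Type) [CommRing R] [Algebra ℚ R] (φ : NCSeries Bool R),
      NCSeries.IsGroupLike φ → NCSeries.DrinfeldPentagon φ →
        NCSeries.piY φ (List.replicate n 2) = algebraMap ℚ R q * φ (MZV.binaryWord [2]) ^ n) :
    q ≠ 0 := by
  intro h0
  have hg : NCSeries.IsGroupLike drinfeldAssociator := drinfeldAssociator_isGroupLike_holds
  have h5 : NCSeries.DrinfeldPentagon drinfeldAssociator := drinfeldAssociator_pentagon_holds
  have h := hq ℝ drinfeldAssociator hg h5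
  rw [h0, map_zero, zero_mul, NCSeries.piY_apply_of_forall_pos _ (MZV.isAdmissible_replicate_two n).1,
    drinfeldAssociator_binaryWord (MZV.isAdmissible_replicate_two n), List.length_replicate,
    multipleZeta_replicate_two] at h
  have hne : Real.pi ^ (2 * n) / ((2 * n + 1).factorial : ℝ) ≠ 0 := by positivity
  rcases mul_eq_zero.mp h with h1 | h1
  · exact pow_ne_zero n (neg_ne_zero.mpr one_ne_zero) h1
  rcases mul_eq_zero.mp h1 with h2 | h2
  · exact pow_ne_zero n (neg_ne_zero.mpr one_ne_zero) h2
  · exact hne h2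

/-- **Registered stub `stub_evenDepthOneLeaf`** of the lead's skeleton v8 (crux
stmt-KontsevichZagierPeriods-15058, line `Sketch`), verbatim: from the neighbouring stubs (i) depth-one
shuffle, (ii) Euler's recursion, (iii) Newton's identity for `π_Y(φ)`, taken as hypotheses, for every
`n ≥ 1` ONE rational `r` with `c_{(2n)}(φ) = r • c_{({2}ⁿ)}(φ)` at every group-like solution of
Drinfeld's pentagon over every commutative `ℚ`-algebra (`r = (-1)ⁿ a_n/q_n`: `c_{(2n)} = a_n c_{(2)}ⁿ`
by (ii), `(-1)ⁿ c_{({2}ⁿ)} = π_Y(φ)({2}ⁿ) = q_n c_{(2)}ⁿ` by (iii), `q_n ≠ 0` at `Φ_KZ`; at `Φ_KZ`: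
`ζ(2n) = [ζ(2n)(2n+1)!/π²ⁿ] ζ(2,…,2)`, Euler × Hoffman). [cite: Brown2012, §3.3 Lemma 3.4] -/
theorem stub_evenDepthOneLeaf :
    (∀ (R : Type) [CommRing R] (φ : NCSeries Bool R), NCSeries.IsGroupLike φ →
      ∀ a b : ℕ, 1 ≤ a → 1 ≤ b →
        φ (MZV.binaryWord [a]) * φ (MZV.binaryWord [b]) =
          ∑ i ∈ Finset.range a, ((b - 1 + i).choose i : R) * φ (MZV.binaryWord [b + i, a - i]) +
            ∑ j ∈ Finset.range b, ((a - 1 + j).choose j : R) * φ (MZV.binaryWord [a + j, b - j])) →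
    (∀ (R : Type) [CommRing R] [Algebra ℚ R] (φ : NCSeries Bool R), NCSeries.IsGroupLike φ →
      NCSeries.DrinfeldPentagon φ →
      (∀ a b : ℕ, 1 ≤ a → 1 ≤ b →
        φ (MZV.binaryWord [a]) * φ (MZV.binaryWord [b]) =
          ∑ i ∈ Finset.range a, ((b - 1 + i).choose i : R) * φ (MZV.binaryWord [b + i, a - i]) +
            ∑ j ∈ Finset.range b, ((a - 1 + j).choose j : R) * φ (MZV.binaryWord [a + j, b - j])) →
      ∀ n : ℕ, 2 ≤ n →
        (2 * n + 1 : R) * φ (MZV.binaryWord [2 * n]) =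
          -2 * ∑ j ∈ Finset.Ico 1 n, φ (MZV.binaryWord [2 * j]) * φ (MZV.binaryWord [2 * (n - j)])) →
    (∀ (R : Type) [CommRing R] [Algebra ℚ R] (φ : NCSeries Bool R), NCSeries.IsGroupLike φ →
      NCSeries.DrinfeldPentagon φ → ∀ m : ℕ, 2 ≤ m → ∀ n : ℕ,
        ((n : R) + 1) * NCSeries.piY φ (List.replicate (n + 1) m) =
          ∑ k ∈ Finset.range (n + 1),
            (-1) ^ k * (NCSeries.piY φ [(k + 1) * m] * NCSeries.piY φ (List.replicate (n - k) m))) →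
    ∀ n : ℕ, 1 ≤ n → ∃ r : ℚ, ∀ (R : Type) [CommRing R] [Algebra ℚ R] (φ : NCSeries Bool R),
      NCSeries.IsGroupLike φ → NCSeries.DrinfeldPentagon φ →
        φ (MZV.binaryWord [2 * n]) = r • φ (MZV.binaryWord (List.replicate n 2)) := by
  intro hSh hEu hNw n hn
  -- Euler's recursion (ii) with its depth-one shuffle input (i) supplied
  have hEu' : ∀ (R : Type) [CommRing R] [Algebra ℚ R] (φ : NCSeries Bool R),
      NCSeries.IsGroupLike φ → NCSeries.DrinfeldPentagon φ → ∀ n : ℕ, 2 ≤ n →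
        (2 * n + 1 : R) * φ (MZV.binaryWord [2 * n]) =
          -2 * ∑ j ∈ Finset.Ico 1 n,
            φ (MZV.binaryWord [2 * j]) * φ (MZV.binaryWord [2 * (n - j)]) :=
    fun R _ _ φ hg h5 => hEu R φ hg h5 (hSh R φ hg)
  obtain ⟨a, ha⟩ := evenLeaf_exists_depthOne hEu'
  obtain ⟨q, hq⟩ := evenLeaf_exists_piY_replicate_upto hNw a ha n
  have hqn : q n ≠ 0 := evenLeaf_q_ne_zero (hq n le_rfl)
  refine ⟨(-1) ^ n * (a n * (q n)⁻¹), fun R _ _ φ hg h5 => ?_⟩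
  have h1 := ha n hn R φ hg h5
  have h2 := hq n le_rfl R φ hg h5
  rw [NCSeries.piY_apply_of_forall_pos φ (MZV.isAdmissible_replicate_two n).1,
    List.length_replicate] at h2
  have h3 := evenLeaf_eq_inv_mul hqn h2.symm
  rw [h1, h3, Algebra.smul_def, map_mul, map_mul, map_pow, map_neg, map_one]
  ring

end Summit.KontsevichZagierPeriods.FurushoPentagon.KernelModuloPeriodConjecture
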